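import Summits.QuantumFields.YangMills.Theorems.BalabanUVNodesN15UnitLayerBgExactDressing
import Summits.QuantumFields.YangMills.Theorems.BalabanUVNodesN15UnitLayerBgQGQPosition

/-!
# Route «BalabanUVNodes», cluster K4 «SpineRates» — node N15 = NE2, file V-C (dag-n15-a g17, programme V): THE EXACT (1.103) DRESSING OF THE (1.66)
# MATRIX — uniform letters on every unit torus (U-B's `dressP_deltaPol_letters` shape, one smallness `ζ ≤ ζ₀`), and the dictionary
# `exDress b Δ^{(n)} Z = (unitBondMat (Q_nG_nQ_n*) + Sym Z)⁻¹ − (b·1 + Δ^{(n)})`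

Cell `pub-ymgap`, seat `pub-ymgap-dag-n15-a` (-a KNIT-BY-NAME seat of node N15; HUMAN RULING D-0062; chair R424 venue), generation 17, file V-C of programme V
(INBOX «DAGN15A-G17-INTENT-1»).  `bears_on: R4∕N15 · K3⁷ SpineGivenEndpointR13SepCoPH (stmt-QuantumFields-20544)`.  Filed `--kind proof --supports
stmt-QuantumFields-20544 --as helper` — COUNT-NEUTRAL.  Theorems only (0 `def`, 0 `sorry`).  Imports V-A (`sOp`, `inv_smul_one_add_deltaPol`, `form_deltaPol_nonneg`) and V-B
(`exDress`, `exDress_isSymm`, `abs_exDress_le`, `abs_exDress_sub_le`); the analytic inputs are `B5Kernel166Decay.kernelDecay166`, `T4Cov2156Rate.kernelRate166` and King's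
`bondSum_le` exactly as in U-B.

WHAT.
* §1 `symPart_add`, `symPart_of_isSymm`, ★ `toMatrix'_qvAdjRe_eq_transpose` (`Q* = n^{d+1}Qᵀ`), ★ `unitBondMat_conj_transpose`, ★★ `symPart_unitBondMat_conj` (`Sym` in the bond basis
  = `Q ((E+Eᵀ)∕2) Q*`: the dressing symmetrises the PROPAGATOR); ★ `exDress_deltaPol_eq` — THE DICTIONARY: on the unit torus of the TwoGrid lineage (`M : Fin (d+1) → ℕ`, `n ≥ 1`, `b > 0`)
  `exDress b (deltaPol M n) Z = (unitBondMat M (sOp M n b) + symPart Z)⁻¹ − (b·1 + deltaPol M n)` — i.e. `Δ^{(n)} + exDress = (Q_n E Q_n*)⁻¹ − b` for ANY operator `E` whose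
  bond matrix `unitBondMat (Q_n E Q_n*)` is `unitBondMat (Q_n G_n Q_n*) + Sym Z`: BAŁABAN's MAP `E ↦ (Q E Q*)⁻¹ − b` (V-A's (1.103)), not its linearisation;
  ★ `smul_one_add_deltaPol_add_exDress_eq_inv_symPart` (`b·1 + Δ^{(n)} + exDress b Δ^{(n)} Z = (Sym X)⁻¹` whenever `X = unitBondMat (Q G Q*) + Z`);
  `exDress_deltaPol_zero` (no middle factor ⟹ no dressing).
* §2 ★★★ **`exDress_deltaPol_letters`** (any dimension `d ≥ 1`, `b > 0`, middle-factor rate `δ_Z > 0`): there are `K, δ′, ζ₀ > 0` (after `d, b, δ_Z`) such that for EVERY unit torus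
  `M`, ALL levels `n₁ ≥ 1`, `n₂ = R·n₁` (`R ≥ 1`) and ALL middle factors `Z, Z′` with `|Z|, |Z′| ≤ ζe^{−δ_Zρ}` (`0 ≤ ζ ≤ ζ₀`), `|Z′ − Z| ≤ τe^{−δ_Zρ}` (`τ ≥ 0`):
  both dressings are SYMMETRIC, (i) `|exDress b Δ^{(n₁)} Z| ≤ Kζe^{−δ′ρ}`, (ii) `|exDress b Δ^{(n₂)} Z′| ≤ Kζe^{−δ′ρ}`, (iii) `|exDress b Δ^{(n₂)} Z′ − exDress b Δ^{(n₁)} Z| ≤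
  K(τ + n₁⁻¹)e^{−δ′ρ}` — the SHAPE of U-B's `dressP_deltaPol_letters` (so U-D's assembly transfers verbatim), the smallness in `ζ` ALONE.

HONEST FRAMING.  Count-neutral; finite linear algebra over tree theorems (V-A, V-B, `kernelDecay166`, `kernelRate166`, `bondSum_le`); constants are this file's; `U ≡ 1` objects
(THE (1.66) matrix) dressed by an abstract middle factor — the model enters only in the consumer V-D.  N15 NOT discharged; nothing continuum ∕ ℝ⁴ ∕ OS ∕ mass-gap ∕ Clay.
Restate-immune (no Theses import).
-/

set_option autoImplicit false

noncomputable section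

open scoped BigOperators Matrix
open Finset Matrix

namespace Summit.QuantumFields.YangMills.BalabanUVNodes.N15.UnitLayerBg

open Literature.MathematicalPhysics.QuantumFieldTheory.Balaban1983to89
open Literature.MathematicalPhysics.QuantumFieldTheory.King1986 (exp_decay_mono)
open Literature.MathematicalPhysics.QuantumFieldTheory.Balaban1983to89.B5Prop11Plancherel (Tor fine)
open Literature.MathematicalPhysics.QuantumFieldTheory.Balaban1983to89.B6Lemma24Torus (pbox)
open Literature.MathematicalPhysics.QuantumFieldTheory.Balaban1983to89.B6BondEliminationTorus (pdist)
open Literature.MathematicalPhysics.QuantumFieldTheory.Balaban1983to89.B6Cov2156Torus (deltaPol deltaPol_isSymm one_le_M)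
open Literature.MathematicalPhysics.QuantumFieldTheory.Balaban1983to89.B5Kernel166Decay (kernelDecay166)
open Literature.MathematicalPhysics.QuantumFieldTheory.Balaban1983to89.T4Cov2156Rate (kernelRate166 bondDist_nonneg bondDist_triangle bondSum_le)
open Literature.MathematicalPhysics.QuantumFieldTheory.Balaban1983to89.B4Sect5Proof (latticeConst latticeConst_nonneg)
open Literature.MathematicalPhysics.QuantumFieldTheory.Balaban1983to89.QGQInverse (Coercive isUnit_of_coercive)
open Summit.QuantumFields.YangMills.BalabanUVNodes.N15.TwoGrid (qvRe qvAdjRe)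

variable {d : ℕ}

/-! ## §1 The dictionary with Bałaban's map `E ↦ (Q E Q*)⁻¹ − b` -/

section Dictionary

/-- `Sym (X + Y) = Sym X + Sym Y`. [folklore] -/
theorem symPart_add {ι : Type} (X Y : Matrix ι ι ℝ) : symPart (X + Y) = symPart X + symPart Y := by
  ext p q
  simp only [Matrix.add_apply, symPart_apply]
  ring

/-- `Sym X = X` for a symmetric `X`. [folklore] -/
theorem symPart_of_isSymm {ι : Type} {X : Matrix ι ι ℝ} (hX : X.IsSymm) : symPart X = X := by
  ext p q
  rw [symPart_apply, hX.apply q p]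
  ring

variable (M : Fin (d + 1) → ℕ) [∀ μ, NeZero (M μ)] (n : ℕ) [NeZero n]

/-- ★ **`Δ^{(n)} + exDress b Δ^{(n)} Z = (unitBondMat (Q_nG_nQ_n*) + Sym Z)⁻¹ − b·1`** — the exact dressing IS Bałaban's `(Q E Q*)⁻¹ − b` (minus `Δ^{(n)}`) at any `E` with
`unitBondMat (Q E Q*) = unitBondMat (Q G Q*) + Sym Z`, by V-A's position-space (1.103) `(b·1 + Δ^{(n)})⁻¹ = unitBondMat (Q_nG_nQ_n*)`.
[cite: Balaban1984PropagatorsI, (1.102)–(1.103) p.34; Balaban1985BackgroundPropagators, (3.185)–(3.187) p.432 (shape of `Δ_k(U)`)] -/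
theorem exDress_deltaPol_eq (hn : 1 ≤ n) {b : ℝ} (hb : 0 < b) (Z : Matrix (B4.Idx (pbox M) (d + 1)) (B4.Idx (pbox M) (d + 1)) ℝ) :
    exDress b (deltaPol M n) Z = (unitBondMat M (sOp M n b) + symPart Z)⁻¹ - (b • (1 : Matrix (B4.Idx (pbox M) (d + 1)) (B4.Idx (pbox M) (d + 1)) ℝ) + deltaPol M n) := by
  rw [exDress, inv_smul_one_add_deltaPol M n hn hb]

/-- … and the dressed form itself: `b·1 + Δ^{(n)} + exDress b Δ^{(n)} Z = (unitBondMat (Q_nG_nQ_n*) + Sym Z)⁻¹`. [cite: Balaban1984PropagatorsI, (1.102)–(1.103) p.34] -/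
theorem smul_one_add_deltaPol_add_exDress (hn : 1 ≤ n) {b : ℝ} (hb : 0 < b) (Z : Matrix (B4.Idx (pbox M) (d + 1)) (B4.Idx (pbox M) (d + 1)) ℝ) :
    b • (1 : Matrix (B4.Idx (pbox M) (d + 1)) (B4.Idx (pbox M) (d + 1)) ℝ) + deltaPol M n + exDress b (deltaPol M n) Z = (unitBondMat M (sOp M n b) + symPart Z)⁻¹ := by
  rw [exDress_deltaPol_eq M n hn hb, add_sub_cancel]

/-- ★ **THE DRESSED FORM IS BAŁABAN's `(Sym Q E Q*)⁻¹ − b` FOR ANY `E` WITH `Q E Q* = Q G Q* + Z` IN BOND CURRENCY**: if `X = unitBondMat (Q_nG_nQ_n*) + Z` then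
`b·1 + Δ^{(n)} + exDress b Δ^{(n)} Z = (Sym X)⁻¹` (the `Q G Q*` part is symmetric, V-A `unitBondMat_sOp_isSymm`). [cite: Balaban1984PropagatorsI, (1.102)–(1.103) p.34] -/
theorem smul_one_add_deltaPol_add_exDress_eq_inv_symPart (hn : 1 ≤ n) {b : ℝ} (hb : 0 < b) {X Z : Matrix (B4.Idx (pbox M) (d + 1)) (B4.Idx (pbox M) (d + 1)) ℝ}
    (hX : X = unitBondMat M (sOp M n b) + Z) :
    b • (1 : Matrix (B4.Idx (pbox M) (d + 1)) (B4.Idx (pbox M) (d + 1)) ℝ) + deltaPol M n + exDress b (deltaPol M n) Z = (symPart X)⁻¹ := by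
  rw [smul_one_add_deltaPol_add_exDress M n hn hb, hX, symPart_add, symPart_of_isSymm (unitBondMat_sOp_isSymm M n hn hb)]


/-- ★ **`Q_n*` IS `n^{d+1}·Q_nᵀ` AS A REAL MATRIX** (β∕b05's `QvAdj = n^{d+1}·QvOpᴴ`, real parts; V-A `toMatrix'_qvRe`∕`toMatrix'_qvAdjRe`). [cite: Balaban1984PropagatorsI, (1.18) p.20, (1.74) p.30] -/
theorem toMatrix'_qvAdjRe_eq_transpose : LinearMap.toMatrix' (qvAdjRe M n) = ((n : ℝ) ^ (d + 1)) • (LinearMap.toMatrix' (qvRe M n))ᵀ := by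
  rw [toMatrix'_qvAdjRe, toMatrix'_qvRe, B5DeltaA169.QvAdj, show ((n : ℂ) ^ (d + 1)) = (((n : ℝ) ^ (d + 1) : ℝ) : ℂ) by push_cast; ring,
    B5RealFields.reM_smul_ofReal, B5RealFields.reM_conjTranspose]

/-- ★ **TRANSPOSITION IN THE BOND BASIS = TRANSPOSING THE FINE OPERATOR**: `(unitBondMat (Q_n T Q_n*))ᵀ = unitBondMat (Q_n Tᵀ Q_n*)` for every operator `T` on fine 1-forms
(`Tᵀ = toLin' (toMatrix' T)ᵀ`; the weights `n^{±(d+1)}` of `Q_n* = n^{d+1}Q_nᵀ` cancel). [folklore] -/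
theorem unitBondMat_conj_transpose (T : (Tor (fine n M) × Fin (d + 1) → ℝ) →ₗ[ℝ] (Tor (fine n M) × Fin (d + 1) → ℝ)) :
    (unitBondMat M (qvRe M n ∘ₗ (T ∘ₗ qvAdjRe M n)))ᵀ = unitBondMat M (qvRe M n ∘ₗ (Matrix.toLin' (LinearMap.toMatrix' T)ᵀ ∘ₗ qvAdjRe M n)) := by
  rw [unitBondMat_eq_submatrix, unitBondMat_eq_submatrix, Matrix.transpose_submatrix, LinearMap.toMatrix'_comp, LinearMap.toMatrix'_comp, LinearMap.toMatrix'_comp,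
    LinearMap.toMatrix'_comp, LinearMap.toMatrix'_toLin', Matrix.transpose_mul, Matrix.transpose_mul, toMatrix'_qvAdjRe_eq_transpose, Matrix.transpose_smul,
    Matrix.transpose_transpose]
  congr 1
  simp only [Matrix.smul_mul, Matrix.mul_smul, Matrix.mul_assoc]

/-- ★★ **THE BOND-BASIS SYMMETRISATION OF `Q E Q*` IS `Q (Sym E) Q*`**: `Sym (unitBondMat (Q_n E Q_n*)) = unitBondMat (Q_n ((E + Eᵀ)∕2) Q_n*)` — so the exact dressing is Bałaban's map
`E ↦ (Q E Q*)⁻¹ − b` applied to the SYMMETRISED dressed propagator `(E₀ + E₀ᵀ)∕2` (a covariance is symmetric). [folklore] -/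
theorem symPart_unitBondMat_conj (T : (Tor (fine n M) × Fin (d + 1) → ℝ) →ₗ[ℝ] (Tor (fine n M) × Fin (d + 1) → ℝ)) :
    symPart (unitBondMat M (qvRe M n ∘ₗ (T ∘ₗ qvAdjRe M n))) =
      unitBondMat M (qvRe M n ∘ₗ (((2 : ℝ)⁻¹ • (T + Matrix.toLin' (LinearMap.toMatrix' T)ᵀ)) ∘ₗ qvAdjRe M n)) := by
  rw [symPart, unitBondMat_conj_transpose, ← unitBondMat_add, ← unitBondMat_smul, LinearMap.smul_comp, LinearMap.comp_smul, LinearMap.add_comp, LinearMap.comp_add]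

/-- No middle factor, no dressing: `exDress b Δ^{(n)} 0 = 0` (`b > 0`). [folklore] -/
theorem exDress_deltaPol_zero {e : ℕ} (N : Fin e → ℕ) [∀ μ, NeZero (N μ)] (hn : 1 ≤ n) {b : ℝ} (hb : 0 < b) : exDress b (deltaPol N n) 0 = 0 :=
  exDress_zero ((Matrix.isUnit_iff_isUnit_det _).mp (isUnit_of_coercive hb (coercive_smul_one_add_deltaPol N n hn b)))

end Dictionary

/-! ## §2 The letters on every unit torus, uniform constants -/

section Letters

variable (d) in
/-- ★★★ **THE LETTERS OF THE EXACT (1.103) DRESSING OF THE (1.66) MATRIX, UNIFORM.**  Let `d ≥ 1`, `b > 0` and a middle-factor rate `δ_Z > 0`.  There are `K, δ′, ζ₀ > 0` (depending on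
`d, b, δ_Z` only) such that for EVERY unit torus `M`, ALL levels `n₁ ≥ 1`, `n₂ = R·n₁` (`R ≥ 1`) and ALL middle factors `Z, Z′` with `|Z(b,b′)|, |Z′(b,b′)| ≤ ζ·e^{−δ_Zρ_M(b₋,b′₋)}`
(`0 ≤ ζ ≤ ζ₀`) and `|Z′(b,b′) − Z(b,b′)| ≤ τ·e^{−δ_Zρ_M(b₋,b′₋)}` (`τ ≥ 0`): `exDress b Δ^{(n₁)} Z` and `exDress b Δ^{(n₂)} Z′` are symmetric,
(i) `|exDress b Δ^{(n₁)} Z (b,b′)| ≤ K·ζ·e^{−δ′ρ}`, (ii) `|exDress b Δ^{(n₂)} Z′ (b,b′)| ≤ K·ζ·e^{−δ′ρ}`, (iii) `|exDress b Δ^{(n₂)} Z′ (b,b′) − exDress b Δ^{(n₁)} Z (b,b′)| ≤ K·(τ + n₁⁻¹)·e^{−δ′ρ}`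
— `Δ^{(n)} = deltaPol M n`; inputs `kernelDecay166`, `kernelRate166`, `form_deltaPol_nonneg`, King's sums `bondSum_le`, V-B. [cite: Balaban1984PropagatorsI, (1.66) p.29, (1.103) p.34 (objects); King1986, (4.40)–(4.41) pp.674–675 (mechanism); CombesThomas1973, §II (mechanism)] [folklore] -/
theorem exDress_deltaPol_letters (hd : 1 ≤ d) {b : ℝ} (hb : 0 < b) {δZ : ℝ} (hδZ : 0 < δZ) :
    ∃ K δ' ζ₀ : ℝ, 0 < K ∧ 0 < δ' ∧ 0 < ζ₀ ∧
      ∀ (M : Fin d → ℕ) [∀ μ, NeZero (M μ)] (n₁ n₂ R : ℕ), 1 ≤ n₁ → 1 ≤ R → n₂ = R * n₁ →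
        ∀ (Z Z' : Matrix (B4.Idx (pbox M) d) (B4.Idx (pbox M) d) ℝ) (ζ τ : ℝ), 0 ≤ ζ → ζ ≤ ζ₀ → 0 ≤ τ →
        (∀ p q : B4.Idx (pbox M) d, |Z p q| ≤ ζ * Real.exp (-(δZ * pdist M (one_le_M M) (p.1 : Fin d → ℤ) (q.1 : Fin d → ℤ)))) →
        (∀ p q : B4.Idx (pbox M) d, |Z' p q| ≤ ζ * Real.exp (-(δZ * pdist M (one_le_M M) (p.1 : Fin d → ℤ) (q.1 : Fin d → ℤ)))) →
        (∀ p q : B4.Idx (pbox M) d, |Z' p q - Z p q| ≤ τ * Real.exp (-(δZ * pdist M (one_le_M M) (p.1 : Fin d → ℤ) (q.1 : Fin d → ℤ)))) →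
        (exDress b (deltaPol M n₁) Z).IsSymm ∧ (exDress b (deltaPol M n₂) Z').IsSymm ∧
        (∀ p q : B4.Idx (pbox M) d, |exDress b (deltaPol M n₁) Z p q|
            ≤ K * ζ * Real.exp (-(δ' * pdist M (one_le_M M) (p.1 : Fin d → ℤ) (q.1 : Fin d → ℤ)))) ∧
        (∀ p q : B4.Idx (pbox M) d, |exDress b (deltaPol M n₂) Z' p q|
            ≤ K * ζ * Real.exp (-(δ' * pdist M (one_le_M M) (p.1 : Fin d → ℤ) (q.1 : Fin d → ℤ)))) ∧
        (∀ p q : B4.Idx (pbox M) d, |exDress b (deltaPol M n₂) Z' p q - exDress b (deltaPol M n₁) Z p q|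
            ≤ K * (τ + (n₁ : ℝ)⁻¹) * Real.exp (-(δ' * pdist M (one_le_M M) (p.1 : Fin d → ℤ) (q.1 : Fin d → ℤ)))) := by
  obtain ⟨c₀, δ₀, hc₀, hδ₀, hK⟩ := kernelDecay166 (d := d) hd
  obtain ⟨θ₀, δ₁, hθ₀, hδ₁, hR⟩ := kernelRate166 (d := d) hd
  -- the common input rate κ
  obtain ⟨κ, hκdef⟩ : ∃ κ : ℝ, κ = min (min δ₀ δ₁) δZ := ⟨_, rfl⟩
  have hκ : 0 < κ := by rw [hκdef]; exact lt_min (lt_min hδ₀ hδ₁) hδZ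
  have hκδ₀ : κ ≤ δ₀ := by rw [hκdef]; exact (min_le_left _ _).trans (min_le_left _ _)
  have hκδ₁ : κ ≤ δ₁ := by rw [hκdef]; exact (min_le_left _ _).trans (min_le_right _ _)
  have hκZ : κ ≤ δZ := by rw [hκdef]; exact min_le_right _ _
  have hd0 : (0 : ℝ) < d := by exact_mod_cast hd
  -- stage S constants
  obtain ⟨V₁, hV₁def⟩ : ∃ V : ℝ, V = (d : ℝ) * latticeConst d (κ / 4) := ⟨_, rfl⟩
  have hV₁0 : 0 ≤ V₁ := by rw [hV₁def]; exact mul_nonneg hd0.le (latticeConst_nonneg d (by positivity))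
  obtain ⟨κ₁, hκ₁def⟩ : ∃ κ₁ : ℝ, κ₁ = min (κ / 4) (b * κ / (4 * (b + c₀) * V₁ + 1)) := ⟨_, rfl⟩
  have hκ₁ : 0 < κ₁ := by rw [hκ₁def]; exact lt_min (by positivity) (by positivity)
  have hκ₁κ : κ₁ ≤ κ / 4 := by rw [hκ₁def]; exact min_le_left _ _
  have hs₁ : 4 * (b + c₀) * V₁ * κ₁ ≤ b * κ := by
    have h1 : κ₁ ≤ b * κ / (4 * (b + c₀) * V₁ + 1) := by rw [hκ₁def]; exact min_le_right _ _
    have h2 : 4 * (b + c₀) * V₁ * κ₁ ≤ (4 * (b + c₀) * V₁ + 1) * κ₁ := by nlinarith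
    have h3 : (4 * (b + c₀) * V₁ + 1) * κ₁ ≤ b * κ := by
      have := mul_le_mul_of_nonneg_left h1 (by positivity : (0 : ℝ) ≤ 4 * (b + c₀) * V₁ + 1)
      rwa [mul_div_cancel₀ _ (by positivity : (4 * (b + c₀) * V₁ + 1 : ℝ) ≠ 0)] at this
    exact h2.trans h3
  obtain ⟨γS, hγS⟩ : ∃ γS : ℝ, γS = b / ((b + c₀) * V₁ + 1) ^ 2 := ⟨_, rfl⟩
  -- stage T constants
  obtain ⟨V₂, hV₂def⟩ : ∃ V : ℝ, V = (d : ℝ) * latticeConst d (κ₁ / 4) := ⟨_, rfl⟩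
  have hV₂0 : 0 ≤ V₂ := by rw [hV₂def]; exact mul_nonneg hd0.le (latticeConst_nonneg d (by positivity))
  obtain ⟨ζ₀, hζ₀def⟩ : ∃ ζ₀ : ℝ, ζ₀ = γS / (2 * V₂ + 1) := ⟨_, rfl⟩
  obtain ⟨κ₂, hκ₂def⟩ : ∃ κ₂ : ℝ, κ₂ = min (κ₁ / 4) (γS * κ₁ / (8 * (2 / b + ζ₀) * V₂ + 1)) := ⟨_, rfl⟩
  obtain ⟨V₃, hV₃def⟩ : ∃ V : ℝ, V = (d : ℝ) * latticeConst d (κ₂ / 2) := ⟨_, rfl⟩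
  have hγpos : 0 < γS := by rw [hγS]; positivity
  have hζ₀ : 0 < ζ₀ := by rw [hζ₀def]; positivity
  have hκ₂ : 0 < κ₂ := by rw [hκ₂def]; exact lt_min (by positivity) (by positivity)
  have hκ₂κ : κ₂ ≤ κ₁ / 4 := by rw [hκ₂def]; exact min_le_left _ _
  have hV₃0 : 0 ≤ V₃ := by rw [hV₃def]; exact mul_nonneg hd0.le (latticeConst_nonneg d (by positivity))
  have hs₂ : ∀ {ζ : ℝ}, 0 ≤ ζ → ζ ≤ ζ₀ → ζ * V₂ ≤ γS / 2 := fun {ζ} hζ hζle => by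
    have h1 : ζ * V₂ ≤ ζ₀ * V₂ := mul_le_mul_of_nonneg_right hζle hV₂0
    have h2 : ζ₀ * V₂ ≤ γS / 2 := by
      rw [hζ₀def, div_mul_eq_mul_div, div_le_iff₀ (by positivity)]
      nlinarith
    exact h1.trans h2
  have hs₃ : ∀ {ζ : ℝ}, 0 ≤ ζ → ζ ≤ ζ₀ → 8 * (2 / b + ζ) * V₂ * κ₂ ≤ γS * κ₁ := fun {ζ} hζ hζle => by
    have h1 : κ₂ ≤ γS * κ₁ / (8 * (2 / b + ζ₀) * V₂ + 1) := by rw [hκ₂def]; exact min_le_right _ _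
    have h2 : 8 * (2 / b + ζ) * V₂ * κ₂ ≤ (8 * (2 / b + ζ₀) * V₂ + 1) * κ₂ := by
      have : 8 * (2 / b + ζ) * V₂ ≤ 8 * (2 / b + ζ₀) * V₂ := by nlinarith
      nlinarith
    have h3 : (8 * (2 / b + ζ₀) * V₂ + 1) * κ₂ ≤ γS * κ₁ := by
      have := mul_le_mul_of_nonneg_left h1 (by positivity : (0 : ℝ) ≤ 8 * (2 / b + ζ₀) * V₂ + 1)
      rwa [mul_div_cancel₀ _ (by positivity : (8 * (2 / b + ζ₀) * V₂ + 1 : ℝ) ≠ 0)] at this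
    exact h2.trans h3
  -- the constant K majorises every amplitude
  obtain ⟨K, hKdef⟩ : ∃ K : ℝ, K = (b + c₀) * (4 / γS) * V₃ ^ 2 + (4 / γS) ^ 2 * V₃ ^ 2 * ((2 / b) ^ 2 * V₂ ^ 2 * θ₀ + 1) + θ₀ + 1 := ⟨_, rfl⟩
  have hKpos : 0 < K := by rw [hKdef]; positivity
  have hT1 : 0 ≤ (b + c₀) * (4 / γS) * V₃ ^ 2 := by positivity
  have hT2 : 0 ≤ (4 / γS) ^ 2 * V₃ ^ 2 * ((2 / b) ^ 2 * V₂ ^ 2 * θ₀ + 1) := by positivity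
  have hT1K : (b + c₀) * (4 / γS) * V₃ ^ 2 ≤ K := by rw [hKdef]; linarith
  refine ⟨K, κ₂ / 2, ζ₀, hKpos, half_pos hκ₂, hζ₀, ?_⟩
  intro M _ n₁ n₂ R' hn₁ hR1 h Z Z' ζ τ hζ hζle hτ hZ hZ' hZZ
  set ρ : B4.Idx (pbox M) d → B4.Idx (pbox M) d → ℝ := fun p q => pdist M (one_le_M M) (p.1 : Fin d → ℤ) (q.1 : Fin d → ℤ) with hρdef
  have hρ0 : ∀ p, ρ p p = 0 := fun p => bondDist_self (one_le_M M) p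
  have hρn : ∀ p q, 0 ≤ ρ p q := bondDist_nonneg (one_le_M M)
  have hρs : ∀ p q, ρ p q = ρ q p := fun p q => bondDist_comm (one_le_M M) p q
  have hρt : ∀ p q r, ρ p r ≤ ρ p q + ρ q r := bondDist_triangle (one_le_M M)
  have hn₂ : 1 ≤ n₂ := by subst h; exact Nat.one_le_iff_ne_zero.mpr (Nat.mul_ne_zero (by omega) (by omega))
  haveI : NeZero n₁ := ⟨by omega⟩
  haveI : NeZero n₂ := ⟨by omega⟩
  have hΔ₁ : ∀ p q, |deltaPol M n₁ p q| ≤ c₀ * Real.exp (-(κ * ρ p q)) := fun p q => (hK M n₁ hn₁ p q).trans (exp_decay_mono hc₀.le hκδ₀ (hρn p q))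
  have hΔ₂ : ∀ p q, |deltaPol M n₂ p q| ≤ c₀ * Real.exp (-(κ * ρ p q)) := fun p q => (hK M n₂ hn₂ p q).trans (exp_decay_mono hc₀.le hκδ₀ (hρn p q))
  have hθn : 0 ≤ θ₀ * (n₁ : ℝ)⁻¹ := mul_nonneg hθ₀.le (inv_nonneg.mpr (Nat.cast_nonneg _))
  have hΔΔ : ∀ p q, |deltaPol M n₂ p q - deltaPol M n₁ p q| ≤ θ₀ * (n₁ : ℝ)⁻¹ * Real.exp (-(κ * ρ p q)) := fun p q =>
    (hR M n₁ n₂ R' hn₁ hR1 h p q).trans (exp_decay_mono hθn hκδ₁ (hρn p q))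
  have hZκ : ∀ p q, |Z p q| ≤ ζ * Real.exp (-(κ * ρ p q)) := fun p q => (hZ p q).trans (exp_decay_mono hζ hκZ (hρn p q))
  have hZ'κ : ∀ p q, |Z' p q| ≤ ζ * Real.exp (-(κ * ρ p q)) := fun p q => (hZ' p q).trans (exp_decay_mono hζ hκZ (hρn p q))
  have hZZκ : ∀ p q, |Z' p q - Z p q| ≤ τ * Real.exp (-(κ * ρ p q)) := fun p q => (hZZ p q).trans (exp_decay_mono hτ hκZ (hρn p q))
  have hP₁ : ∀ x, 0 ≤ x ⬝ᵥ (deltaPol M n₁ *ᵥ x) := form_deltaPol_nonneg M n₁ hn₁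
  have hP₂ : ∀ x, 0 ≤ x ⬝ᵥ (deltaPol M n₂ *ᵥ x) := form_deltaPol_nonneg M n₂ hn₂
  have hW₁ : ∀ p, ∑ q, Real.exp (-(κ / 4 * ρ p q)) ≤ V₁ := fun p => by rw [hV₁def]; exact bondSum_le (one_le_M M) (by positivity) p
  have hW₂ : ∀ p, ∑ q, Real.exp (-(κ₁ / 4 * ρ p q)) ≤ V₂ := fun p => by rw [hV₂def]; exact bondSum_le (one_le_M M) (by positivity) p
  have hW₃ : ∀ p, ∑ q, Real.exp (-(κ₂ / 2 * ρ p q)) ≤ V₃ := fun p => by rw [hV₃def]; exact bondSum_le (one_le_M M) (by positivity) p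
  refine ⟨exDress_isSymm b (deltaPol_isSymm M n₁) Z, exDress_isSymm b (deltaPol_isSymm M n₂) Z', fun p q => ?_, fun p q => ?_, fun p q => ?_⟩
  · refine (abs_exDress_le ρ hρn hρs hρ0 hρt hb hc₀.le hκ hκ₁ hκ₁κ hκ₂.le hκ₂κ hζ hP₁ hΔ₁ hZκ hW₁ hW₂ hW₃ hγS hs₁ (hs₂ hζ hζle) (hs₃ hζ hζle) p q).trans ?_
    refine mul_le_mul_of_nonneg_right ?_ (Real.exp_nonneg _)
    have : (b + c₀) * ζ * (4 / γS) * V₃ ^ 2 = ((b + c₀) * (4 / γS) * V₃ ^ 2) * ζ := by ring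
    rw [this]
    refine mul_le_mul_of_nonneg_right ?_ hζ
    exact hT1K
  · refine (abs_exDress_le ρ hρn hρs hρ0 hρt hb hc₀.le hκ hκ₁ hκ₁κ hκ₂.le hκ₂κ hζ hP₂ hΔ₂ hZ'κ hW₁ hW₂ hW₃ hγS hs₁ (hs₂ hζ hζle) (hs₃ hζ hζle) p q).trans ?_
    refine mul_le_mul_of_nonneg_right ?_ (Real.exp_nonneg _)
    have : (b + c₀) * ζ * (4 / γS) * V₃ ^ 2 = ((b + c₀) * (4 / γS) * V₃ ^ 2) * ζ := by ring
    rw [this]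
    refine mul_le_mul_of_nonneg_right ?_ hζ
    exact hT1K
  · refine (abs_exDress_sub_le ρ hρn hρs hρ0 hρt hb hc₀.le hκ hκ₁ hκ₁κ hκ₂.le hκ₂κ hζ hθn hτ hP₁ hΔ₁ hP₂ hΔ₂ hZκ hZ'κ hΔΔ hZZκ hW₁ hW₂ hW₃ hγS hs₁
      (hs₂ hζ hζle) (hs₃ hζ hζle) p q).trans ?_
    refine mul_le_mul_of_nonneg_right ?_ (Real.exp_nonneg _)
    have hn0 : 0 ≤ (n₁ : ℝ)⁻¹ := inv_nonneg.mpr (Nat.cast_nonneg _)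
    -- each coefficient is ≤ K
    have hx : 0 ≤ (4 / γS) ^ 2 * V₃ ^ 2 * ((2 / b) ^ 2 * V₂ ^ 2 * θ₀) := by positivity
    have hy : 0 ≤ (4 / γS) ^ 2 * V₃ ^ 2 := by positivity
    have hsplit : (4 / γS) ^ 2 * V₃ ^ 2 * ((2 / b) ^ 2 * V₂ ^ 2 * θ₀ + 1) = (4 / γS) ^ 2 * V₃ ^ 2 * ((2 / b) ^ 2 * V₂ ^ 2 * θ₀) + (4 / γS) ^ 2 * V₃ ^ 2 := by ring
    have hB : (4 / γS) ^ 2 * V₃ ^ 2 ≤ K := by rw [hKdef, hsplit]; linarith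
    have hAC : (4 / γS) ^ 2 * V₃ ^ 2 * ((2 / b) ^ 2 * V₂ ^ 2 * θ₀) + θ₀ ≤ K := by rw [hKdef, hsplit]; linarith
    calc (4 / γS) ^ 2 * V₃ ^ 2 * ((2 / b) ^ 2 * V₂ ^ 2 * (θ₀ * (n₁ : ℝ)⁻¹) + τ) + θ₀ * (n₁ : ℝ)⁻¹
        = ((4 / γS) ^ 2 * V₃ ^ 2 * ((2 / b) ^ 2 * V₂ ^ 2 * θ₀) + θ₀) * (n₁ : ℝ)⁻¹ + (4 / γS) ^ 2 * V₃ ^ 2 * τ := by ring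
      _ ≤ K * (n₁ : ℝ)⁻¹ + K * τ := add_le_add (mul_le_mul_of_nonneg_right hAC hn0) (mul_le_mul_of_nonneg_right hB hτ)
      _ = K * (τ + (n₁ : ℝ)⁻¹) := by ring

end Letters

end Summit.QuantumFields.YangMills.BalabanUVNodes.N15.UnitLayerBg

end
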